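import Mathlib

/-!
# An `ε`-depleted cell has a level set that `B` loads and `A` avoids

Crux `Summit.MatrixMultiplication.MatrixMultiplication.Theses.SnSubsetDichotomy.PolynomialSlack`
(item `stmt-MatrixMultiplication-8306`), level-one programme, line transport-split-hull (lead c10),
the `ε`-depleted matching branch of the 3/4 step (generalising c8's `scatter_cell`, which needs the
cell to be depleted to `1/128` of uniform).  A heavy cell `(k, i)` of the sparse quotient is
`ε`-DEPLETED when the forced hits `∑_j d_A(i,j) d_B(j,k)` are at most `(1-ε)/n`; here `p = d_A(i,·)`
(the law of `a⁻¹ i`, a probability vector) and `q = d_B(·,k)` (the law of `b k`).  Then some set `L`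
carries `q`-mass `≥ ε'` while `p` puts at most `(1-ε')|L|/n` on it,
`ε' = ε²/(12 (1+log n)(2+log(1/ε)))`: either `L` is big and `A` avoids it at row `i`, or `L` is small
and `B` over-hits it at position `k` (`matching_cost_avoid_eps` / `matching_cost_hit_eps`).

Proof (a Markov cut on `p`, no layer cake needed).  Take the sub-level set of `p`,
`L = {j : n p_j < 1 - ε'}`.  On `L` each `p_j < (1-ε')/n`, so `p(L) ≤ (1-ε')|L|/n` termwise.  Off `L`,
`n p_j ≥ 1 - ε'`, so `(1-ε') q(Lᶜ) ≤ n ∑_{Lᶜ} p_j q_j ≤ n ∑_j p_j q_j ≤ 1 - ε`; as `ε' ≤ ε/2`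
(the denominator of `ε'` is at least `24` and `ε ≤ 1`), `1 - ε ≤ 1 - 2ε' ≤ (1-ε')²`, whence
`q(Lᶜ) ≤ 1 - ε'` and `q(L) = 1 - q(Lᶜ) ≥ ε'`.
-/

set_option linter.dupNamespace false

open scoped BigOperators

namespace Summit.MatrixMultiplication.MatrixMultiplication.Theorems.PolynomialSlack

/-- **Level set of an `ε`-depleted cell.**  For probability vectors `p, q` on `Fin n` (`n ≥ 2`) with
`∑_j p_j q_j ≤ (1 - ε)/n` (`0 < ε ≤ 1`) there is a set `L` with `∑_{j ∈ L} q_j ≥ ε'` and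
`∑_{j ∈ L} p_j ≤ (1 - ε') |L|/n`, where `ε' = ε²/(12 (1 + log n) (2 + log (1/ε)))`: the sub-level
set `L = {j : n p_j < 1 - ε'}` of `p` works, since `(1 - ε') ∑_{j ∉ L} q_j ≤ n ∑_j p_j q_j ≤ 1 - ε`
and `ε' ≤ ε/2`. [folklore] -/
theorem depleted_cell_level {n : ℕ} (hn : 2 ≤ n) (p q : Fin n → ℝ) (hp0 : ∀ j, 0 ≤ p j)
    (hq0 : ∀ j, 0 ≤ q j) (hp1 : ∑ j, p j = 1) (hq1 : ∑ j, q j = 1) (ε : ℝ) (hε : 0 < ε)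
    (hε1 : ε ≤ 1) (hdep : ∑ j, p j * q j ≤ (1 - ε) / n) :
    ∃ L : Finset (Fin n),
      ε ^ 2 / (12 * (1 + Real.log n) * (2 + Real.log (1 / ε))) ≤ ∑ j ∈ L, q j ∧
      ∑ j ∈ L, p j ≤ (1 - ε ^ 2 / (12 * (1 + Real.log n) * (2 + Real.log (1 / ε)))) *
        (L.card : ℝ) / n := by
  -- `Fin n` is nonempty, as `p` has total mass `1`; and `1 ≤ n`
  have hn0 : 0 < n := Nat.pos_of_ne_zero (by rintro rfl; simp at hp1)
  have hnR : (0 : ℝ) < n := by exact_mod_cast hn0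
  have hn1 : (1 : ℝ) ≤ n := by exact_mod_cast (le_trans (by norm_num) hn : 1 ≤ n)
  -- the denominator `D = 12 (1 + log n) (2 + log (1/ε)) ≥ 24`, so `ε' = ε²/D ≤ ε/2`
  have hlogn : 0 ≤ Real.log n := Real.log_nonneg hn1
  have hlogε : 0 ≤ Real.log (1 / ε) := Real.log_nonneg ((one_le_div hε).2 hε1)
  set D : ℝ := 12 * (1 + Real.log n) * (2 + Real.log (1 / ε))
  have hD : 24 ≤ D := by nlinarith [mul_nonneg hlogn hlogε]
  have hDpos : 0 < D := by linarith
  have hε'0 : 0 ≤ ε ^ 2 / D := by positivity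
  have hε'le : ε ^ 2 / D ≤ ε / 2 := by
    rw [div_le_iff₀ hDpos]
    have h1 : ε / 2 * 24 ≤ ε / 2 * D := mul_le_mul_of_nonneg_left hD (by linarith)
    have h2 : ε * ε ≤ 1 * ε := mul_le_mul_of_nonneg_right hε1 hε.le
    nlinarith [h1, h2]
  set ε' : ℝ := ε ^ 2 / D
  -- the sub-level set `L = {j : n p_j < 1 - ε'}` of `p`
  obtain ⟨L, hL⟩ : ∃ L : Finset (Fin n), ∀ j, j ∈ L ↔ (n : ℝ) * p j < 1 - ε' :=
    ⟨Finset.univ.filter (fun j => (n : ℝ) * p j < 1 - ε'), fun j => by simp⟩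
  refine ⟨L, ?_, ?_⟩
  · -- (a) off `L`, `n p_j ≥ 1 - ε'`, so `(1 - ε') q(Lᶜ) ≤ n ∑ p q ≤ 1 - ε`
    have hsplit : ∑ j ∈ L, q j + ∑ j ∈ Lᶜ, q j = 1 := by
      rw [Finset.sum_add_sum_compl, hq1]
    have hcomp : (1 - ε') * ∑ j ∈ Lᶜ, q j ≤ 1 - ε := by
      calc (1 - ε') * ∑ j ∈ Lᶜ, q j = ∑ j ∈ Lᶜ, (1 - ε') * q j := Finset.mul_sum _ _ _
        _ ≤ ∑ j ∈ Lᶜ, (n : ℝ) * p j * q j := by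
            apply Finset.sum_le_sum
            intro j hj
            have hj' : 1 - ε' ≤ (n : ℝ) * p j :=
              not_lt.1 (fun h => Finset.mem_compl.1 hj ((hL j).2 h))
            exact mul_le_mul_of_nonneg_right hj' (hq0 j)
        _ ≤ ∑ j, (n : ℝ) * p j * q j :=
            Finset.sum_le_sum_of_subset_of_nonneg (Finset.subset_univ _)
              (fun j _ _ => mul_nonneg (mul_nonneg hnR.le (hp0 j)) (hq0 j))
        _ = (n : ℝ) * ∑ j, p j * q j := by
            rw [Finset.mul_sum]
            exact Finset.sum_congr rfl (fun j _ => mul_assoc _ _ _)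
        _ ≤ (n : ℝ) * ((1 - ε) / n) := mul_le_mul_of_nonneg_left hdep hnR.le
        _ = 1 - ε := mul_div_cancel₀ _ hnR.ne'
    -- `1 - ε ≤ 1 - 2ε' ≤ (1 - ε')²`, whence `q(Lᶜ) ≤ 1 - ε'` and `q(L) = 1 - q(Lᶜ) ≥ ε'`
    have h2 : ∑ j ∈ Lᶜ, q j ≤ 1 - ε' := by
      by_contra h
      have h3 : (1 - ε') * (1 - ε') < (1 - ε') * ∑ j ∈ Lᶜ, q j :=
        mul_lt_mul_of_pos_left (not_le.1 h) (by linarith)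
      nlinarith [sq_nonneg ε']
    linarith
  · -- (b) on `L` each `n p_j < 1 - ε'`, so `n p(L) ≤ (1 - ε') |L|`
    rw [le_div_iff₀ hnR]
    calc (∑ j ∈ L, p j) * n = ∑ j ∈ L, (n : ℝ) * p j := by
          rw [Finset.sum_mul]
          exact Finset.sum_congr rfl (fun j _ => mul_comm _ _)
      _ ≤ ∑ j ∈ L, (1 - ε') := Finset.sum_le_sum (fun j hj => ((hL j).1 hj).le)
      _ = (1 - ε') * (L.card : ℝ) := by
          rw [Finset.sum_const, nsmul_eq_mul, mul_comm]

end Summit.MatrixMultiplication.MatrixMultiplication.Theorems.PolynomialSlack
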